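import Literature.Geometry.Kaehler.ChartWindowWeakLimit
import Literature.Geometry.Kaehler.LimitConeWindows
import Literature.Geometry.Kaehler.ChartWindowCurrent
import Literature.Geometry.GeometricMeasureTheory.CurrentsRepresentable
import HarnessLib

/-!
# Chart windows of the tangent cone, II: the weak limit over a window is a multiple of the cone

Let `T` be a holomorphic `p`-chain (`p = q + 1`) with support of pure dimension `p`, `b ∈ Ω`,
`F = limitCone |T| hb` the limit cone at `b`, `M = limitConeReg |T| hb p` its regular part of
dimension `p` and `C₁ = limitConeUnitChain` the unit tangent-cone chain (every conic component with
multiplicity `1`, `LimitConeChain.lean`, `LimitConeCharts.lean`). For a chart window `W` of the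
tangent cone (`LimitConeWindows.lean`: centred at `y ∈ M` over `T_y F`, graph `Ψ(ball) ⊆ reg|C₁|`,
`F ∩ closedTube ⊆ Ψ(ball)`):

* `multAt_limitConeChain_of_mem_limitConeComp`, `density_limitConeChain_of_mem_limitConeComp` —
  on the component `C(y)` of `reg F` through `y ∈ M` the tangent-cone chain with multiplicities `d`
  has density `d(cl C(y))` (a component met by the closure of another equals it,
  [Chirka1989, §5.4 Thm. (1)]); in particular `C₁` has density `1` there;
* `HolomorphicChain.exists_chartWindow_subset` — windows of the tangent cone inside any prescribed
  open neighbourhood of `y`, together with their graphs `Ψ(ball 0 ρ)`;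
* `ChartWindow.orthogonalProjection_chartDeriv` — `P_K ∘ DΨ(k) = id` (differentiating
  `P_K(Ψ k − m) = k`);
* `HolomorphicChain.carrier_limitConeUnitChain_inter_innerCore` — `reg|C₁| ∩ innerCore = Ψ(ball 0 a₃)`;
* `HolomorphicChain.graphCurrent_apply_eq_toCurrent_apply` — **`[Γ](ψ) = [C₁](ψ)` for every test
  form `ψ` supported in the inner core**: over the window the graph current with multiplicity `1`
  IS the current of the unit tangent cone (`HolomorphicChain.currentOfIntegration_image_eq_graphData`:
  a holomorphic chain read in an orthonormal chart is a graph current, [Federer1969, 4.1.28, 4.3.18]);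
* `HolomorphicChain.graphCurrent_probe_eq_probeIntegral` — **`[Γ](ψ_W) = I_W > 0`** for the probe
  form `ψ_W = χ · q^*(β om₀)` of the window (supported in the inner core): the unit tangent cone is a
  nonzero current near every point of `M`;
* `HolomorphicChain.tendsto_blowUp_apply_toCurrent_limitConeUnitChain` — with the sheet number
  `c` of the window and the eventual tube condition for every `η` (`LimitConeWindows.lean`,
  `ChartWindowWeakLimit.lean`): **`D_r(ψ) → c · [C₁](ψ)` as `r → 0⁺`** for every test form `ψ` on
  the unit ball supported in the inner core — the blow-ups of `T` converge weakly, near every regular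
  direction of the tangent cone, to an integer multiple of the cone [Harvey1977, Thm. 1.31];
  [Federer1969, 4.3.18]; and `c · I_W = D_r(ψ_W)` exactly for small `r`
  (`HolomorphicChain.sheetNumber_mul_probeIntegral_eq`, the sheet identity of `ChartWindowSheets.lean`
  with the support of the probe form recorded).

Theorems only; no definitions, no named facts.

## References

* H. Federer, *Geometric Measure Theory*, Springer 1969, 4.1.28, 4.1.31, 4.3.16–4.3.18 [Federer1969].
* R. Harvey, *Holomorphic chains and their boundaries*, PSPUM XXX.1 (1977), §1.10, Thm. 1.31
  [Harvey1977].
* E. M. Chirka, *Complex Analytic Sets*, Kluwer 1989, §5.4, §8.1 [Chirka1989].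
* J. R. King, *The currents defined by analytic varieties*, Acta Math. 127 (1971), §5.
-/

noncomputable section

open scoped Manifold Topology ENNReal NNReal InnerProductSpace ContDiff Distributions
open Set Filter MeasureTheory Metric Function Module TopologicalSpace

namespace Literature.Geometry.Kaehler

open Literature.Geometry.GeometricMeasureTheory

-- Nested operator-norm instances on (duals of) `V [⋀^Fin n]→L[ℝ] ℝ`.
set_option maxSynthPendingDepth 2

universe u

variable {V : Type u} [NormedAddCommGroup V] [InnerProductSpace ℂ V] [FiniteDimensional ℂ V]

/-! ### Densities of tangent-cone chains along a component -/

section Density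

variable {Ω : Opens V} {A : Set Ω} {b : V} {p : ℕ}

/-- **On the component `C(y)` of `reg F` through `y ∈ M`, the tangent-cone chain with
multiplicities `d` has multiplicity `d(cl C(y))`**: the only conic component containing a point of
`C(y)` is `cl C(y)` (a component met by the closure of another equals it).
[cite: Chirka1989, §5.4 Thm. (1)] -/
theorem multAt_limitConeChain_of_mem_limitConeComp (hA : HasPureDim 𝓘(ℂ, V) A p)
    (hb : b ∈ (Ω : Set V)) (d : Set (⊤ : Opens V) → ℤ) {y x : (⊤ : Opens V)}
    (hy : y ∈ limitConeReg A hb p) (hx : x ∈ limitConeComp A hb y) :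
    (limitConeChain hA hb d).multAt x = d (limitConeIrr A hb y) := by
  classical
  rw [HolomorphicChain.multAt_eq_mult (Z := limitConeIrr A hb y) (subset_closure hx),
    limitConeChain_mult_of_mem hA hb d ⟨y, hy, rfl⟩]
  intro Z' hZ' hxZ'
  have hmem : Z' ∈ limitConeComponents A hb p := by
    by_contra h
    exact hZ' (limitConeChain_mult_of_not_mem hA hb d h)
  obtain ⟨y', hy', rfl⟩ := hmem
  have hcomp : limitConeComp A hb y' = limitConeComp A hb y :=
    limitConeComp_eq_of_limitConeIrr_inter_nonempty ⟨x, hxZ', hx⟩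
  simp only [limitConeIrr, hcomp]

/-- The density of the tangent-cone chain with multiplicities `d` at (the point of `V` under) a
point of the component `C(y)` is `d(cl C(y))`. [cite: Chirka1989, §5.4 Thm. (1)] -/
theorem density_limitConeChain_of_mem_limitConeComp [MeasurableSpace V] [BorelSpace V]
    (hA : HasPureDim 𝓘(ℂ, V) A p) (hb : b ∈ (Ω : Set V)) (d : Set (⊤ : Opens V) → ℤ)
    {y x : (⊤ : Opens V)} (hy : y ∈ limitConeReg A hb p) (hx : x ∈ limitConeComp A hb y) :
    (limitConeChain hA hb d).density (x : V) = d (limitConeIrr A hb y) := by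
  rw [HolomorphicChain.density_apply_coe]
  exact multAt_limitConeChain_of_mem_limitConeComp hA hb d hy hx

/-- **The unit tangent-cone chain has density `1` on every component of `reg F` through a point of
`M`.** [cite: Chirka1989, §5.4 Thm. (1)] -/
theorem density_limitConeUnitChain_of_mem_limitConeComp [MeasurableSpace V] [BorelSpace V]
    (hA : HasPureDim 𝓘(ℂ, V) A p) (hb : b ∈ (Ω : Set V)) {y x : (⊤ : Opens V)}
    (hy : y ∈ limitConeReg A hb p) (hx : x ∈ limitConeComp A hb y) :
    (limitConeUnitChain hA hb).density (x : V) = 1 :=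
  density_limitConeChain_of_mem_limitConeComp hA hb _ hy hx

/-- Near a point of `M`, in an open set `N` on which `F` coincides with the component `C(y)`, the
unit tangent-cone chain has density `1` at every point of its carrier. [cite: Chirka1989, §5.4] -/
theorem density_limitConeUnitChain_eq_one_of_mem_carrier [MeasurableSpace V] [BorelSpace V]
    (hA : HasPureDim 𝓘(ℂ, V) A p) (hb : b ∈ (Ω : Set V)) {y : (⊤ : Opens V)}
    (hy : y ∈ limitConeReg A hb p) {N : Set (⊤ : Opens V)}
    (hFN : limitConeTop A hb ∩ N = limitConeComp A hb y ∩ N) {x : V}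
    (hx : x ∈ (limitConeUnitChain hA hb).carrier ∩ ((↑) : (⊤ : Opens V) → V) '' N) :
    (limitConeUnitChain hA hb).density x = 1 := by
  obtain ⟨hxc, ⟨x', hx'N, rfl⟩⟩ := hx
  have hxF : x' ∈ limitConeTop A hb := carrier_limitConeUnitChain_subset hA hb hxc
  have hxC : x' ∈ limitConeComp A hb y := (hFN.subset ⟨hxF, hx'N⟩ : _).1
  exact density_limitConeUnitChain_of_mem_limitConeComp hA hb hy hxC

end Density

/-! ### A window identity: `P_K ∘ DΨ(k) = id` -/

namespace ChartWindow

variable (W : ChartWindow V)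

/-- **`P_K ∘ DΨ(k) = id`** on the chart ball (differentiate `P_K(Ψ k − m) = k`).
[cite: Federer1969, 4.3.18] -/
theorem orthogonalProjection_chartDeriv {k : W.K} (hk : k ∈ ball (0 : W.K) W.ρ) (u : W.K) :
    W.K.orthogonalProjectionOnto (W.chartDeriv k u) = u := by
  have hB : ball (0 : W.K) W.ρ ∈ 𝓝 k := isOpen_ball.mem_nhds hk
  have h1 : HasFDerivAt (fun k' => W.K.orthogonalProjectionOnto (W.Ψ k' - W.m))
      (W.K.orthogonalProjectionOnto.comp (fderiv ℂ W.Ψ k)) k :=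
    W.K.orthogonalProjectionOnto.hasFDerivAt.comp k
      (((W.differentiableOn k hk).differentiableAt hB).hasFDerivAt.sub_const W.m)
  have h2 : HasFDerivAt (fun k' => W.K.orthogonalProjectionOnto (W.Ψ k' - W.m))
      (ContinuousLinearMap.id ℂ W.K) k :=
    (hasFDerivAt_id k).congr_of_eventuallyEq (eventually_of_mem hB fun k' hk' => W.proj_eq k' hk')
  have h := congrArg (fun f : W.K →L[ℂ] W.K => f u) (h1.unique h2)
  simpa [ChartWindow.chartDeriv] using h

/-- Graph points over `ball 0 a₃` lie in the inner core. [folklore] -/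
private theorem chart_mem_innerCore {k : W.K} (hk : k ∈ ball (0 : W.K) W.a₃) :
    W.Ψ k ∈ W.innerCore := by
  have hkρ : k ∈ ball (0 : W.K) W.ρ :=
    ball_subset_ball (W.a₃_lt.trans (W.a₂_lt.trans W.a₁_lt)).le hk
  refine ⟨?_, ?_⟩
  · rw [W.kf_chart hkρ]; exact mem_ball_zero_iff.1 hk
  · rw [W.wf_chart hkρ, norm_zero]; linarith [W.τ_pos]

/-- Graph points over `ball 0 a₃` lie where the cutoff is `1`. [folklore] -/
private theorem chart_mem_cutoffOne {k : W.K} (hk : k ∈ ball (0 : W.K) W.a₃) :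
    W.Ψ k ∈ W.cutoffOne := by
  have hkρ : k ∈ ball (0 : W.K) W.ρ :=
    ball_subset_ball (W.a₃_lt.trans (W.a₂_lt.trans W.a₁_lt)).le hk
  refine ⟨?_, ?_⟩
  · rw [W.kf_chart hkρ]; exact (mem_ball_zero_iff.1 hk).trans W.a₃_lt_aLo
  · rw [W.wf_chart hkρ, norm_zero]; linarith [W.τ_pos]

end ChartWindow

namespace HolomorphicChain

variable [MeasurableSpace V] [BorelSpace V] {Ω : Opens V} {q : ℕ}

/-! ### Windows of the tangent cone inside a prescribed open set -/

/-- **Windows of the tangent cone inside a prescribed open neighbourhood.** For `y ∈ M` and an open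
`O ∋ y` there is a chart window of the tangent cone centred at `y` (all the properties of
`exists_chartWindow_of_mem_limitConeReg`) whose closed tube AND whose graph `Ψ(ball 0 ρ)` lie in `O`
(for the windows of `LimitConeWindows.lean`, `a₁ = ρ/2 ≤ ε` because the graph over `ball 0 a₁` lies in
the closed tube `⊆ 𝐁(y, ε)` and `‖k‖ ≤ ‖Ψ k − y‖`, while `‖Ψ k − y‖ ≤ (3/2)‖k‖`).
[cite: Federer1969, 4.3.18; Chirka1989, §2.3, §8.1] -/
theorem exists_chartWindow_subset (T : HolomorphicChain 𝓘(ℂ, V) Ω (q + 1))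
    (hA : HasPureDim 𝓘(ℂ, V) T.support (q + 1)) {b : V} (hb : b ∈ (Ω : Set V)) {y : (⊤ : Opens V)}
    (hy : y ∈ limitConeReg T.support hb (q + 1)) {O : Set V} (hO : IsOpen O) (hyO : (y : V) ∈ O) :
    ∃ W : ChartWindow V, W.m = y ∧ finrank ℂ W.K = q + 1 ∧ W.Ψ 0 = y ∧
      fderiv ℂ W.Ψ 0 = W.K.subtypeL ∧
      (∀ k ∈ ball (0 : W.K) W.ρ, ‖fderiv ℂ W.Ψ k - W.K.subtypeL‖ ≤ 1 / 2) ∧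
      (∀ k ∈ ball (0 : W.K) W.ρ, ‖fderiv ℂ W.Ψ k‖ ≤ 2) ∧
      W.τ ≤ (W.a₁ ^ 2 - W.a₂ ^ 2) / (2 * W.ρ) ∧
      W.closedTube ⊆ O ∧ W.Ψ '' ball (0 : W.K) W.ρ ⊆ O ∧
      (y : V) ∈ W.innerCore ∧
      (∀ k ∈ ball (0 : W.K) W.ρ, W.Ψ k ∈ (limitConeUnitChain hA hb).carrier) ∧
      W.Ψ '' ball (0 : W.K) W.ρ ⊆ limitCone T.support hb ∧
      (∀ k ∈ ball (0 : W.K) W.ρ,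
        approxTangentCone (2 * (q + 1)) ((μHE[2 * (q + 1)] : Measure V).restrict
          (limitConeUnitChain hA hb).carrier) (W.Ψ k) = Set.range (fderiv ℂ W.Ψ k)) ∧
      limitCone T.support hb ∩ W.closedTube ⊆ W.Ψ '' ball (0 : W.K) W.ρ ∧
      (∀ x ∈ limitCone T.support hb ∩ W.closedTube, W.wf x = 0) := by
  obtain ⟨ε₀, hε₀, hε₀O⟩ := nhds_basis_closedBall.mem_iff.1 (hO.mem_nhds hyO)
  have hε : 0 < ε₀ / 4 := by positivity
  obtain ⟨W, hm, hKp, hΨ0, hDΨ, hD, hM, ha₁, ha₂, ha₃, hτ', hτ, htube, hinn, -, hcar, hΨF, htan,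
    hFW, hFW0⟩ := T.exists_chartWindow_of_mem_limitConeReg hA hb hy hε
  -- `a₁ ≤ ε₀/4`: the graph over `ball 0 a₁` lies in the closed tube
  haveI : Nontrivial W.K := Module.nontrivial_of_finrank_pos (R := ℂ) (by rw [hKp]; omega)
  have ha₁ε : W.a₁ ≤ ε₀ / 4 := by
    by_contra hlt
    push Not at hlt
    obtain ⟨u, hu⟩ := exists_ne (0 : W.K)
    have hu0 : 0 < ‖u‖ := norm_pos_iff.2 hu
    set t : ℝ := (ε₀ / 4 + W.a₁) / 2 with ht
    have ht0 : 0 < t := by rw [ht]; linarith [W.a₁_pos]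
    have hta : t < W.a₁ := by rw [ht]; linarith
    set k : W.K := ((t / ‖u‖ : ℝ) : ℂ) • u with hkdef
    have hk : ‖k‖ = t := by
      rw [hkdef, norm_smul, Complex.norm_real, Real.norm_of_nonneg (by positivity),
        div_mul_cancel₀ _ hu0.ne']
    have hkρ : k ∈ ball (0 : W.K) W.ρ := mem_ball_zero_iff.2 (by rw [hk]; linarith [W.a₁_lt])
    have hkT : W.Ψ k ∈ W.closedTube := by
      refine ⟨?_, ?_⟩
      · rw [W.kf_chart hkρ, hk]; exact hta.le
      · rw [W.wf_chart hkρ, norm_zero]; exact W.τ_pos.le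
    have h1 : ‖W.Ψ k - (y : V)‖ ≤ ε₀ / 4 := by
      have := htube hkT
      rwa [mem_closedBall, dist_eq_norm] at this
    have h2 : ‖k‖ ≤ ‖W.Ψ k - (y : V)‖ := by
      have hproj := W.proj_eq k hkρ
      rw [hm] at hproj
      calc ‖k‖ = ‖W.K.orthogonalProjectionOnto (W.Ψ k - (y : V))‖ := by rw [hproj]
        _ ≤ ‖W.Ψ k - (y : V)‖ := W.K.norm_orthogonalProjectionOnto_apply_le _
    linarith
  have hρε : W.ρ ≤ ε₀ / 2 := by rw [show W.ρ = 2 * W.a₁ by rw [ha₁]; ring]; linarith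
  -- the graph lies in `ball y (3ρ/2) ⊆ O`
  have hΨO : W.Ψ '' ball (0 : W.K) W.ρ ⊆ O := by
    rintro _ ⟨k, hk, rfl⟩
    refine hε₀O ?_
    rw [mem_closedBall, dist_eq_norm]
    have h := OrthoChart.norm_sub_le W.differentiableOn le_rfl hD hk (mem_ball_self W.ρ_pos)
    rw [hΨ0, sub_zero] at h
    have hk' : ‖k‖ < W.ρ := mem_ball_zero_iff.1 hk
    nlinarith
  refine ⟨W, hm, hKp, hΨ0, hDΨ, hD, hM, hτ, htube.trans ((closedBall_subset_closedBall
    (by linarith)).trans hε₀O), hΨO, hinn, hcar, hΨF, htan, hFW, hFW0⟩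

/-! ### The graph current of a window of the tangent cone is the unit tangent cone -/

/-- **`reg|C₁| ∩ innerCore = Ψ(ball 0 a₃)`** for a window of the tangent cone: the carrier of the
unit tangent-cone chain meets the inner core exactly in the graph over `ball 0 a₃`.
[cite: Federer1969, 4.3.18] -/
theorem carrier_limitConeUnitChain_inter_innerCore (T : HolomorphicChain 𝓘(ℂ, V) Ω (q + 1))
    (hA : HasPureDim 𝓘(ℂ, V) T.support (q + 1)) {b : V} (hb : b ∈ (Ω : Set V)) (W : ChartWindow V)
    (hcar : ∀ k ∈ ball (0 : W.K) W.ρ, W.Ψ k ∈ (limitConeUnitChain hA hb).carrier)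
    (hFW : limitCone T.support hb ∩ W.closedTube ⊆ W.Ψ '' ball (0 : W.K) W.ρ) :
    (limitConeUnitChain hA hb).carrier ∩ W.innerCore = W.Ψ '' ball (0 : W.K) W.a₃ := by
  refine Subset.antisymm ?_ ?_
  · rintro x ⟨hxc, hxI⟩
    have hxF : x ∈ limitCone T.support hb := carrier_limitConeUnitChain_subset hA hb hxc
    have hxT : x ∈ W.closedTube :=
      W.tube_subset_closedTube (W.core_subset_tube (W.innerCore_subset_core hxI))
    obtain ⟨k, hk, rfl⟩ := hFW ⟨hxF, hxT⟩
    refine ⟨k, mem_ball_zero_iff.2 ?_, rfl⟩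
    have := hxI.1
    rwa [W.kf_chart hk] at this
  · rintro _ ⟨k, hk, rfl⟩
    exact ⟨hcar k (ball_subset_ball (W.a₃_lt.trans (W.a₂_lt.trans W.a₁_lt)).le hk),
      ChartWindow.chart_mem_innerCore W hk⟩

/-- **`[Γ](ψ) = [C₁](ψ)` over the window**: for a window of the tangent cone (graph in `reg|C₁|`,
tangent spaces `im DΨ`, `F ∩ closedTube = ` graph, and `C₁` of density `1` on its carrier inside an
open `N ⊇ Ψ(ball 0 a₃)`), the graph current with multiplicity `1` and the complex orientation agrees
with the current of the unit tangent-cone chain on every test form supported in the inner core.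
[cite: Federer1969, 4.1.28, 4.3.18; Harvey1977, App. A.2] -/
theorem graphCurrent_apply_eq_toCurrent_apply (T : HolomorphicChain 𝓘(ℂ, V) Ω (q + 1))
    (hA : HasPureDim 𝓘(ℂ, V) T.support (q + 1)) {b : V} (hb : b ∈ (Ω : Set V)) (W : ChartWindow V)
    (hKp : finrank ℂ W.K = q + 1) (bK : OrthonormalBasis (Fin (q + 1)) ℂ W.K)
    (e : letI : InnerProductSpace ℝ W.K := InnerProductSpace.complexToReal
      OrthonormalBasis (Fin (2 * (q + 1))) ℝ W.K)
    (he : ⇑e = complexFrame ⇑bK)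
    (hcar : ∀ k ∈ ball (0 : W.K) W.ρ, W.Ψ k ∈ (limitConeUnitChain hA hb).carrier)
    (htan : ∀ k ∈ ball (0 : W.K) W.ρ,
      approxTangentCone (2 * (q + 1)) ((μHE[2 * (q + 1)] : Measure V).restrict
        (limitConeUnitChain hA hb).carrier) (W.Ψ k) = Set.range (fderiv ℂ W.Ψ k))
    (hFW : limitCone T.support hb ∩ W.closedTube ⊆ W.Ψ '' ball (0 : W.K) W.ρ)
    {N : Set V} (hN : IsOpen N) (hΨN : W.Ψ '' ball (0 : W.K) W.a₃ ⊆ N)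
    (hdens : ∀ x ∈ (limitConeUnitChain hA hb).carrier ∩ N, (limitConeUnitChain hA hb).density x = 1)
    (ψ : TestForm (⊤ : Opens V) (2 * (q + 1))) (hψ : tsupport ⇑ψ ⊆ W.innerCore) :
    letI : InnerProductSpace ℝ V := InnerProductSpace.complexToReal
    W.graphCurrent e 1 W.a₃ ψ = (limitConeUnitChain hA hb).toCurrent ψ := by
  letI : InnerProductSpace ℝ V := InnerProductSpace.complexToReal
  letI : InnerProductSpace ℝ W.K := InnerProductSpace.complexToReal
  set C₁ := limitConeUnitChain hA hb with hC₁
  have ha₃ρ : W.a₃ ≤ W.ρ := (W.a₃_lt.trans (W.a₂_lt.trans W.a₁_lt)).le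
  -- `C₁` has density `1` a.e. on `reg|C₁| ∩ N`
  have hdens' : ∀ᵐ x ∂((μHE[2 * (q + 1)] : Measure V).restrict (C₁.carrier ∩ N)), C₁.density x = 1 :=
    ae_restrict_of_forall_mem (C₁.measurableSet_carrier.inter hN.measurableSet) hdens
  -- the chain read in the chart is the graph current
  have hG := C₁.currentOfIntegration_image_eq_graphData W hKp bK hcar htan hdens' ha₃ρ
    measurableSet_ball (subset_refl _) hΨN (Ω' := (⊤ : Opens V)) e he
  have hΓ : W.graphCurrent e 1 W.a₃ =
      currentOfIntegration (W.Ψ '' ball (0 : W.K) W.a₃) C₁.density C₁.orientationFrame := by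
    rw [hG]; rfl
  -- `[C₁](ψ) = [reg|C₁| ∩ innerCore](ψ) = [Ψ(ball 0 a₃)](ψ)`
  have hdata := Harvey1977_isRectifiableData_toCurrent_holds V (⊤ : Opens V) (q + 1) C₁
  have hrepr := hdata.isRepresentable
  have hsupp : Function.support ⇑ψ ⊆ W.innerCore := (subset_tsupport _).trans hψ
  rw [hΓ, HolomorphicChain.toCurrent,
    ← hrepr.restrictSet_apply_of_support_subset W.isOpen_innerCore.measurableSet hsupp,
    hdata.restrictSet_eq W.isOpen_innerCore.measurableSet,
    T.carrier_limitConeUnitChain_inter_innerCore hA hb W hcar hFW]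

/-! ### The probe form: the unit tangent cone is nonzero over every window -/

/-- **`[Γ](ψ_W) = I_W`** for the probe form `ψ_W = χ · q^*(β om₀)` of the window (`om₀(e) = 1`):
on the flat disc `q ∘ g = q`, `P_K ∘ DΨ = id` and the cutoffs are `1`, so `g^* ψ_W` restricts to
`β om₀` and `[Γ](ψ_W) = g_#[disc](ψ_W) = ∫_{disc} β = I_W`. [cite: Federer1969, 4.1.7, 4.1.31, 4.3.18] -/
theorem _root_.Literature.Geometry.Kaehler.ChartWindow.graphCurrent_probe_eq_probeIntegral
    (W : ChartWindow V) (hKp : finrank ℂ W.K = q + 1)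
    {M : ℝ} (hM : ∀ k ∈ ball (0 : W.K) W.ρ, ‖fderiv ℂ W.Ψ k‖ ≤ M)
    (e : letI : InnerProductSpace ℝ W.K := InnerProductSpace.complexToReal
      OrthonormalBasis (Fin (2 * (q + 1))) ℝ W.K)
    (om₀ : Covector V (2 * (q + 1))) (hom₀ : om₀ (fun i => ((e i : W.K) : V)) = 1) :
    letI : InnerProductSpace ℝ V := InnerProductSpace.complexToReal
    W.graphCurrent e 1 W.a₃ (TestForm.pullback (W.cutoff hM) W.contDiff_proj (W.probeForm om₀)) =
      W.probeIntegral (2 * (q + 1)) := by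
  letI : InnerProductSpace ℝ V := InnerProductSpace.complexToReal
  letI : InnerProductSpace ℝ W.K := InnerProductSpace.complexToReal
  haveI : FiniteDimensional ℝ W.K := FiniteDimensional.complexToReal W.K
  -- a cutoff `χ' = 1` near the closed disc, and `[Γ] = g_#[disc]`
  have hKc : IsCompact ((fun k : W.K => W.m + (k : V)) '' closedBall (0 : W.K) W.a₃) :=
    (isCompact_closedBall _ _).image (continuous_const.add continuous_subtype_val)
  obtain ⟨χ', U', -, hKU', hχ'1, -⟩ := exists_testFunction_eq_one_nhds (Ω := (⊤ : Opens V)) hKc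
    (subset_univ _)
  have hpush := W.pushforward_disc_eq_graphCurrent hKp e 1 hM χ' hKU' hχ'1
  rw [Int.cast_one, one_smul] at hpush
  rw [← hpush, Current.pushforward_apply]
  -- evaluate the flat disc current
  set D : Set V := W.slab ∩ {x | x - W.m ∈ W.K} with hD
  have hDm : MeasurableSet D :=
    W.isOpen_slab.measurableSet.inter (W.K.closed_of_finiteDimensional.preimage
      (continuous_id.sub continuous_const)).measurableSet
  have hDfin : (μHE[2 * (q + 1)] : Measure V) D < ⊤ := W.measure_slab_inter_plane_lt_top hKp
  have hli : LocallyIntegrableOn (fun _ : V => ((1 : ℤ) : ℝ) • frameVector fun i => ((e i : W.K) : V))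
      ((⊤ : Opens V) : Set V) ((μHE[2 * (q + 1)] : Measure V).restrict D) := by
    haveI : IsFiniteMeasure ((μHE[2 * (q + 1)] : Measure V).restrict D) :=
      ⟨by rwa [Measure.restrict_apply_univ]⟩
    exact (integrable_const _).locallyIntegrable.locallyIntegrableOn _
  rw [currentOfIntegration_apply hli, ChartWindow.probeIntegral]
  refine setIntegral_congr_fun hDm fun x hx => ?_
  -- on the disc: `x = m + k`, `‖k‖ < a₃`
  obtain ⟨hxslab, hxK⟩ := hx
  have hkfx : ((W.kf x : W.K) : V) = x - W.m := by
    simp only [ChartWindow.kf]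
    have := W.K.orthogonalProjectionOnto_mem_subspace_eq_self ⟨x - W.m, hxK⟩
    rw [this]
  have hk : W.kf x ∈ ball (0 : W.K) W.a₃ := mem_ball_zero_iff.2 hxslab
  have hkρ : W.kf x ∈ ball (0 : W.K) W.ρ :=
    ball_subset_ball (W.a₃_lt.trans (W.a₂_lt.trans W.a₁_lt)).le hk
  have hk₁ : ‖W.kf x‖ < W.a₁ := (mem_ball_zero_iff.1 hk).trans (W.a₃_lt.trans W.a₂_lt)
  have hgx : W.graphMap x = W.Ψ (W.kf x) := W.graphMap_eq hk₁.le
  have hqgx : W.proj (W.graphMap x) = x := by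
    rw [hgx, ChartWindow.proj, W.kf_chart hkρ, hkfx, add_sub_cancel]
  have hxdisc : x ∈ (fun k : W.K => W.m + (k : V)) '' closedBall (0 : W.K) W.a₃ :=
    ⟨W.kf x, mem_closedBall_zero_iff.2 (mem_ball_zero_iff.1 hk).le, by
      show W.m + ((W.kf x : W.K) : V) = x
      rw [hkfx, add_sub_cancel]⟩
  have hχ'x : χ' x = 1 := hχ'1 x (hKU' hxdisc)
  have hcut : W.cutoff hM (W.graphMap x) = 1 := by
    rw [hgx]; exact W.cutoff_eq_one hM (ChartWindow.chart_mem_cutoffOne W hk)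
  -- the derivatives along the disc frame
  have hDg : fderiv ℝ W.graphMap x = (W.chartDeriv (W.kf x)).comp
      (W.K.orthogonalProjectionOnto.restrictScalars ℝ) := (W.hasFDerivAt_graphMap hk₁).fderiv
  have hDq : fderiv ℝ W.proj (W.graphMap x) = (W.K.subtypeL.restrictScalars ℝ).comp
      (W.K.orthogonalProjectionOnto.restrictScalars ℝ) := (W.hasFDerivAt_proj _).fderiv
  have hframe : (fun i => fderiv ℝ W.proj (W.graphMap x) (fderiv ℝ W.graphMap x ((e i : W.K) : V))) =
      fun i => ((e i : W.K) : V) := by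
    funext i
    rw [hDg, hDq]
    simp only [ContinuousLinearMap.coe_comp, comp_apply, ContinuousLinearMap.coe_restrictScalars',
      Submodule.subtypeL_apply, W.K.orthogonalProjectionOnto_mem_subspace_eq_self,
      W.orthogonalProjection_chartDeriv hkρ]
  rw [Int.cast_one, one_mul, TestForm.pullback_apply, hχ'x, one_smul,
    ContinuousAlternatingMap.compContinuousLinearMap_apply, TestForm.pullback_apply, hcut, one_smul,
    ContinuousAlternatingMap.compContinuousLinearMap_apply, ChartWindow.probeForm_apply,
    ContinuousAlternatingMap.smul_apply, smul_eq_mul, hqgx]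
  change W.probeBump x * om₀ (fun i => fderiv ℝ W.proj (W.graphMap x)
    (fderiv ℝ W.graphMap x ((e i : W.K) : V))) = W.probeBump x
  rw [hframe, hom₀, mul_one]

/-- **The unit tangent cone is a nonzero current over every window**: `[Γ](ψ_W) > 0` for the probe
form of the window, which is supported in the inner core. [cite: Federer1969, 4.1.31, 4.3.18] -/
theorem _root_.Literature.Geometry.Kaehler.ChartWindow.graphCurrent_probe_pos (W : ChartWindow V) (hKp : finrank ℂ W.K = q + 1)
    {M : ℝ} (hM : ∀ k ∈ ball (0 : W.K) W.ρ, ‖fderiv ℂ W.Ψ k‖ ≤ M)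
    (e : letI : InnerProductSpace ℝ W.K := InnerProductSpace.complexToReal
      OrthonormalBasis (Fin (2 * (q + 1))) ℝ W.K)
    (om₀ : Covector V (2 * (q + 1))) (hom₀ : om₀ (fun i => ((e i : W.K) : V)) = 1) :
    letI : InnerProductSpace ℝ V := InnerProductSpace.complexToReal
    0 < W.graphCurrent e 1 W.a₃ (TestForm.pullback (W.cutoff hM) W.contDiff_proj (W.probeForm om₀)) ∧
      tsupport ⇑(TestForm.pullback (W.cutoff hM) W.contDiff_proj (W.probeForm om₀)) ⊆ W.innerCore := by
  letI : InnerProductSpace ℝ V := InnerProductSpace.complexToReal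
  refine ⟨?_, W.tsupport_pullback_cutoff_subset_innerCore hM _ (W.tsupport_probeForm_subset om₀)⟩
  rw [W.graphCurrent_probe_eq_probeIntegral hKp hM e om₀ hom₀]
  exact W.probeIntegral_pos hKp

/-! ### The weak limit over a window of the tangent cone -/

variable (T : HolomorphicChain 𝓘(ℂ, V) Ω (q + 1)) (hA : HasPureDim 𝓘(ℂ, V) T.support (q + 1))
  {b : V} (hb : b ∈ (Ω : Set V)) {r₀ : ℝ} (hr₀ : 0 < r₀)
  (hΩ : closedBall b r₀ ⊆ (Ω : Set V)) (W : ChartWindow V) (hKp : finrank ℂ W.K = q + 1) {ρ₀ : ℝ}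
  (hρ₀ : ρ₀ < 1) (hW : W.closedTube ⊆ closedBall (0 : V) ρ₀)
  (htube : ∀ r ∈ Ioo 0 r₀, T.blowUpSet b r ∩ W.closedTube ⊆ {x | ‖W.wf x‖ < W.τ / 16})

include hr₀ hΩ hKp hρ₀ hW htube in
/-- **The blow-ups converge weakly to an integer multiple of the unit tangent cone over every window
of the tangent cone**: with `c` the sheet number of the window and the eventual tube condition for
every `η > 0`, `D_r(ψ) → c · [C₁](ψ)` as `r → 0⁺` for every test form `ψ` on the unit ball supported
in the inner core. [cite: Harvey1977, Thm. 1.31; Federer1969, 4.3.18] -/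
theorem tendsto_blowUp_apply_toCurrent_limitConeUnitChain {M : ℝ} (hM0 : 0 ≤ M)
    (hM : ∀ k ∈ ball (0 : W.K) W.ρ, ‖fderiv ℂ W.Ψ k‖ ≤ M)
    (hτ : W.τ ≤ (W.a₁ ^ 2 - W.a₂ ^ 2) / (2 * W.ρ)) (bK : OrthonormalBasis (Fin (q + 1)) ℂ W.K)
    (e : letI : InnerProductSpace ℝ W.K := InnerProductSpace.complexToReal
      OrthonormalBasis (Fin (2 * (q + 1))) ℝ W.K)
    (he : ⇑e = complexFrame ⇑bK)
    {c : ℤ} (hsheet : ∀ r ∈ Ioo 0 r₀, ∃ hQr : (T.projPiece b r W hM).IsRepresentable,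
      hQr.restrictSet W.slab W.isOpen_slab.measurableSet =
        currentOfIntegration (W.slab ∩ {x | x - W.m ∈ W.K}) (fun _ => c)
          (fun _ => fun i => ((e i : W.K) : V)))
    (hfine : ∀ η : ℝ, 0 < η →
      ∀ᶠ r in 𝓝[>] (0 : ℝ), T.blowUpSet b r ∩ W.closedTube ⊆ {x | ‖W.wf x‖ < η})
    (hcar : ∀ k ∈ ball (0 : W.K) W.ρ, W.Ψ k ∈ (limitConeUnitChain hA hb).carrier)
    (htan : ∀ k ∈ ball (0 : W.K) W.ρ,
      approxTangentCone (2 * (q + 1)) ((μHE[2 * (q + 1)] : Measure V).restrict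
        (limitConeUnitChain hA hb).carrier) (W.Ψ k) = Set.range (fderiv ℂ W.Ψ k))
    (hFW : limitCone T.support hb ∩ W.closedTube ⊆ W.Ψ '' ball (0 : W.K) W.ρ)
    {N : Set V} (hN : IsOpen N) (hΨN : W.Ψ '' ball (0 : W.K) W.a₃ ⊆ N)
    (hdens : ∀ x ∈ (limitConeUnitChain hA hb).carrier ∩ N, (limitConeUnitChain hA hb).density x = 1)
    (ψ : TestForm (unitBall V) (2 * (q + 1))) (hψ : tsupport ⇑ψ ⊆ W.innerCore) :
    letI : InnerProductSpace ℝ V := InnerProductSpace.complexToReal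
    Tendsto (fun r => T.blowUp b r ψ) (𝓝[>] (0 : ℝ))
      (𝓝 ((c : ℝ) * (limitConeUnitChain hA hb).toCurrent (TestFunction.monoCLM ℝ ψ))) := by
  letI : InnerProductSpace ℝ V := InnerProductSpace.complexToReal
  have hle : unitBall V ≤ (⊤ : Opens V) := le_top
  have hψ' : tsupport ⇑(TestFunction.monoCLM ℝ ψ : TestForm (⊤ : Opens V) (2 * (q + 1))) ⊆
      W.innerCore := by
    rw [TestForm.monoCLM_apply_of_le hle]; exact hψ
  rw [← T.graphCurrent_apply_eq_toCurrent_apply hA hb W hKp bK e he hcar htan hFW hN hΨN hdens _ hψ']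
  exact T.tendsto_blowUp_apply_of_tsupport_subset_innerCore hr₀ hΩ W hKp hρ₀ hW htube hM0 hM hτ e
    hsheet hfine ψ hψ

include hΩ hKp hρ₀ hW in
/-- **The sheet identity with the probe form**: `c · I_W = D_r(ψ_W)` for all `0 < r < r₀`, where
`ψ_W` is the probe form of the window regarded on the unit ball (it is supported in the inner core).
[cite: Federer1969, 4.1.31, 4.3.16] -/
theorem sheetNumber_mul_probeIntegral_eq {M : ℝ} (hM : ∀ k ∈ ball (0 : W.K) W.ρ, ‖fderiv ℂ W.Ψ k‖ ≤ M)
    (e : letI : InnerProductSpace ℝ W.K := InnerProductSpace.complexToReal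
      OrthonormalBasis (Fin (2 * (q + 1))) ℝ W.K)
    (om₀ : Covector V (2 * (q + 1))) (hom₀ : om₀ (fun i => ((e i : W.K) : V)) = 1)
    {c : ℤ} {r : ℝ} (hr : r ∈ Ioo 0 r₀) (hQr : (T.projPiece b r W hM).IsRepresentable)
    (hc : hQr.restrictSet W.slab W.isOpen_slab.measurableSet =
      currentOfIntegration (W.slab ∩ {x | x - W.m ∈ W.K}) (fun _ => c)
        (fun _ => fun i => ((e i : W.K) : V)))
    (ψ : TestForm (unitBall V) (2 * (q + 1)))
    (hψ : (TestFunction.monoCLM ℝ ψ : TestForm (⊤ : Opens V) (2 * (q + 1))) =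
      TestForm.pullback (W.cutoff hM) W.contDiff_proj (W.probeForm om₀)) :
    letI : InnerProductSpace ℝ V := InnerProductSpace.complexToReal
    (c : ℝ) * W.probeIntegral (2 * (q + 1)) = T.blowUp b r ψ := by
  letI : InnerProductSpace ℝ V := InnerProductSpace.complexToReal
  have hball : ball b r ⊆ (Ω : Set V) :=
    (ball_subset_closedBall.trans (closedBall_subset_closedBall hr.2.le)).trans hΩ
  have hIC : W.innerCore ⊆ closedBall (0 : V) ρ₀ := innerCore_subset_closedBall W hW
  have hsupp : tsupport ⇑ψ ⊆ W.innerCore := by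
    have h := W.tsupport_pullback_cutoff_subset_innerCore hM _ (W.tsupport_probeForm_subset om₀)
    rw [← hψ, TestForm.monoCLM_apply_of_le (show unitBall V ≤ (⊤ : Opens V) from le_top)] at h
    exact h
  have h1 : T.projPiece b r W hM (W.probeForm om₀) = c * W.probeIntegral (2 * (q + 1)) := by
    rw [← hQr.restrictSet_apply_of_support_subset W.isOpen_slab.measurableSet
      (W.support_probeForm_subset om₀), hc, W.currentOfIntegration_disc_probeForm hKp c _ om₀, hom₀,
      mul_one]
  have h2 : T.projPiece b r W hM (W.probeForm om₀) = T.blowUp b r ψ := by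
    rw [projPiece, Current.pushforward_apply, corePiece,
      T.blowUp_apply_eq_blowUpPiece hr.1 hball W.isOpen_innerCore.measurableSet hρ₀ hIC ψ hsupp, hψ]
  rw [← h1, h2]

omit [MeasurableSpace V] [BorelSpace V] in
include hρ₀ hW in
/-- The probe form of a window whose inner core lies in `𝐁(0, ρ₀)`, `ρ₀ < 1`, as a test form on the
unit ball (it is supported in the inner core). [cite: Federer1969, 4.1.31] -/
theorem _root_.Literature.Geometry.Kaehler.ChartWindow.exists_probe_testForm_unitBall {M : ℝ}
    (hM : ∀ k ∈ ball (0 : W.K) W.ρ, ‖fderiv ℂ W.Ψ k‖ ≤ M) (om₀ : Covector V (2 * (q + 1))) :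
    ∃ ψ : TestForm (unitBall V) (2 * (q + 1)),
      (TestFunction.monoCLM ℝ ψ : TestForm (⊤ : Opens V) (2 * (q + 1))) =
        TestForm.pullback (W.cutoff hM) W.contDiff_proj (W.probeForm om₀) ∧
      tsupport ⇑ψ ⊆ W.innerCore := by
  set ψp : TestForm (⊤ : Opens V) (2 * (q + 1)) :=
    TestForm.pullback (W.cutoff hM) W.contDiff_proj (W.probeForm om₀) with hψp
  have hψp_supp : tsupport ⇑ψp ⊆ W.innerCore :=
    W.tsupport_pullback_cutoff_subset_innerCore hM _ (W.tsupport_probeForm_subset om₀)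
  have hIC : W.innerCore ⊆ closedBall (0 : V) ρ₀ := innerCore_subset_closedBall W hW
  have hψp1 : tsupport ⇑ψp ⊆ ((unitBall V : Opens V) : Set V) :=
    (hψp_supp.trans hIC).trans (closedBall_subset_ball hρ₀)
  refine ⟨⟨ψp, ψp.contDiff, ψp.hasCompactSupport, hψp1⟩, ?_, hψp_supp⟩
  ext x v
  rw [TestForm.monoCLM_apply_of_le (show unitBall V ≤ (⊤ : Opens V) from le_top)]
  rfl

end HolomorphicChain

end Literature.Geometry.Kaehler
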